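import Summits.Ventures.PercRepro.C026TwoCluster

/-!
# The Q-path lemma (mine-3 §42 (e) (2); p6, gen 18)

For a `(D,A)` source `T` with blue clusters `Y_t = cluster Tᶜ t` and `Y_j = cluster Tᶜ j` of the two
terminals, suppose the red reach of `c` avoiding `Y_t` meets `Y_j` at `w`, and let `Q` be a set of
`T`-blue edges inside `Y_j` carrying a walk from `w` to `j` (a blue path of `T` inside the cluster
of `j`).  Then opening `Q` leaves the blue cluster of `t` unchanged (`cluster_compl_sup_of_inside`)
and `c` reaches `j` in `T ⊔ Q` avoiding it (`qpath_good`): `T ⊔ Q` is a member of the cluster cube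
of `T` in `Good_t` — mine-3's «promote the entry» targets, the lemma-certified `Bad → SG` pairs of
the cluster-cube certificate system (CC).
-/

namespace PercRepro

namespace MultiGraph

open Finset

variable {V E : Type*} {G : MultiGraph V E}

/-- Opening edges that lie inside a set disjoint from `Y_t` does not change the blue cluster of `t`
(`Y_t = cluster Tᶜ t`): a blue walk from `t` stays inside `Y_t`, and none of its edges is inside the
other set. -/
theorem cluster_compl_sup_of_inside {T Q : Config E} {Y : Set V} {t : V}
    (hdisj : Disjoint (G.cluster Tᶜ t) Y)
    (hQ : ∀ e, Q e = true → G.fst e ∈ Y ∧ G.snd e ∈ Y) :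
    G.cluster (T ⊔ Q)ᶜ t = G.cluster Tᶜ t := by
  ext v
  simp only [mem_cluster]
  constructor
  · intro h
    exact Conn.mono (by rw [compl_sup]; exact inf_le_left) h
  · intro h
    refine Conn.induction (G := G) (ω := Tᶜ) (u := t) (motive := fun w => G.Conn (T ⊔ Q)ᶜ t w)
      (Conn.refl G _ t) ?_ h
    intro p q htp hpq ih
    obtain ⟨e, he, hend⟩ := hpq
    refine ih.trans (Conn.of_openAdj ⟨e, ?_, hend⟩)
    -- `e` is blue in `T`; it is not in `Q` because `p ∈ Y_t` lies outside `Y`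
    have hp : p ∈ G.cluster Tᶜ t := (G.mem_cluster).2 htp
    have hnotQ : Q e = false := by
      cases hQe : Q e
      · rfl
      · exfalso
        have hboth := hQ e hQe
        rcases hend with ⟨h1, _⟩ | ⟨_, h2⟩
        · exact Set.disjoint_left.1 hdisj hp (h1 ▸ hboth.1)
        · exact Set.disjoint_left.1 hdisj hp (h2 ▸ hboth.2)
    have hT : T e = false := by
      rw [Pi.compl_apply] at he
      cases hT : T e
      · rfl
      · rw [hT] at he
        exact absurd he (by decide)
    rw [Pi.compl_apply, Pi.sup_apply, hT, hnotQ]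
    decide

/-- **The Q-path lemma** (mine-3 §42 (e) (2)).  Let `Y_t = cluster Tᶜ t` and `Y_j = cluster Tᶜ j` be
disjoint, let `c` reach `w ∈ Y_j` in `T` avoiding `Y_t`, and let `Q` be a set of edges inside `Y_j`
carrying a `Q`-open walk from `w` to `j` inside `Y_j`.  Then in `T ⊔ Q` the vertex `c` reaches `j`
avoiding the (unchanged) blue cluster of `t`: `T ⊔ Q ∈ Good_t`. -/
theorem qpath_good {T Q : Config E} {t j c w : V}
    (hdisj : Disjoint (G.cluster Tᶜ t) (G.cluster Tᶜ j))
    (hQ : ∀ e, Q e = true → G.fst e ∈ G.cluster Tᶜ j ∧ G.snd e ∈ G.cluster Tᶜ j)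
    (hcw : G.WalkAvoiding T (G.cluster Tᶜ t) c w) (hwj : G.WalkInside Q (G.cluster Tᶜ j) w j) :
    G.WalkAvoiding (T ⊔ Q) (G.cluster (T ⊔ Q)ᶜ t) c j := by
  rw [cluster_compl_sup_of_inside hdisj hQ]
  refine ⟨hcw.1, ?_⟩
  -- the `T`-walk to `w` is `T ⊔ Q`-open; the `Q`-walk from `w` to `j` inside `Y_j` avoids `Y_t`
  have h1 : Relation.ReflTransGen
      (fun x y => G.OpenAdj (T ⊔ Q) x y ∧ y ∉ G.cluster Tᶜ t) c w :=
    reflTransGen_of_imp (fun _ _ hxy => ⟨hxy.1.mono le_sup_left, hxy.2⟩) hcw.2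
  have h2 : Relation.ReflTransGen
      (fun x y => G.OpenAdj (T ⊔ Q) x y ∧ y ∉ G.cluster Tᶜ t) w j :=
    reflTransGen_of_imp (fun _ _ hxy =>
      ⟨hxy.1.mono le_sup_right, Set.disjoint_left.1 hdisj.symm hxy.2⟩) hwj.2
  exact h1.trans h2

omit G in
/-- Along a walk whose steps start outside `Y`, every vertex before the last is outside `Y`. -/
theorem reflTransGen_avoiding_of_sources {α : Type*} {r : α → α → Prop} {Y W : Set α} (hWY : W ⊆ Y)
    {u w : α} (h : Relation.ReflTransGen (fun x y => r x y ∧ x ∉ Y) u w) (hw : w ∉ W) (hu : u ∉ W) :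
    Relation.ReflTransGen (fun x y => r x y ∧ y ∉ W) u w := by
  induction h using Relation.ReflTransGen.head_induction_on with
  | refl => exact Relation.ReflTransGen.refl
  | @head u x hux hxw ih =>
    have hx : x ∉ W := by
      rcases Relation.ReflTransGen.cases_head hxw with rfl | ⟨y, hxy, _⟩
      · exact hw
      · exact fun hxW => hxy.2 (hWY hxW)
    exact Relation.ReflTransGen.head ⟨hux.1, hx⟩ (ih hx)

/-- **A clean source is never Bad** (mine-3 §35 (d) / §42): if the blue clusters of the two distinct
terminals are the singletons `{a}` and `{b}` and `c ~ a` in red, then `c` reaches `b` avoiding `{a}`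
or `c` reaches `a` avoiding `{b}` — cut a red path from `c` to `a` at its first vertex in `{a, b}`. -/
theorem good_of_clean {T : Config E} {a b c : V} (hab : a ≠ b) (hca : G.Conn T c a)
    (ha : G.cluster Tᶜ a = {a}) (hb : G.cluster Tᶜ b = {b}) :
    G.WalkAvoiding T (G.cluster Tᶜ a) c b ∨ G.WalkAvoiding T (G.cluster Tᶜ b) c a := by
  rw [ha, hb]
  obtain ⟨w, hw, hwalk⟩ := exists_first_mem_of_conn (Y := ({a, b} : Set V)) hca (by simp)
  have hsrc : c ∉ ({a, b} : Set V) ∨ c = w := by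
    rcases Relation.ReflTransGen.cases_head hwalk with rfl | ⟨y, hcy, _⟩
    · exact Or.inr rfl
    · exact Or.inl hcy.2
  have hcb : c ∉ ({a, b} : Set V) → c ∉ ({b} : Set V) := fun h hc =>
    h (Set.mem_insert_iff.2 (Or.inr hc))
  have hca' : c ∉ ({a, b} : Set V) → c ∉ ({a} : Set V) := fun h hc =>
    h (Set.mem_insert_iff.2 (Or.inl (Set.mem_singleton_iff.1 hc)))
  rcases hw with hwa | hwb
  · -- the path reaches `a` first: it avoids `b`
    subst hwa
    have hwb : w ∉ ({b} : Set V) := by simpa using hab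
    have hc : c ∉ ({b} : Set V) := by
      rcases hsrc with h | rfl
      · exact hcb h
      · exact hwb
    exact Or.inr ⟨hc, reflTransGen_avoiding_of_sources (W := {b})
      (fun x hx => Set.mem_insert_iff.2 (Or.inr hx)) hwalk hwb hc⟩
  · -- the path reaches `b` first: it avoids `a`
    subst hwb
    have hwa : w ∉ ({a} : Set V) := by simpa using hab.symm
    have hc : c ∉ ({a} : Set V) := by
      rcases hsrc with h | rfl
      · exact hca' h
      · exact hwa
    exact Or.inl ⟨hc, reflTransGen_avoiding_of_sources (W := {a})
      (fun x hx => Set.mem_insert_iff.2 (Or.inl (Set.mem_singleton_iff.1 hx))) hwalk hwa hc⟩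

end MultiGraph

end PercRepro
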